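import Summits.Ventures.YMGap.YM3IR.CovariantFamily
import HarnessLib

/-!
# YM₃ infrared statement — `YM3IR/AxialFamily.lean`: the structural clauses of `IRConjecture3Cov` are INHABITED by the
axial (straight-line) block map (cell `pub-ymgap`, track Y4; ym3ir-theory-1, gen 5)

HONEST FRAMING. WHAT THIS IS: a CONSISTENCY CERTIFICATE for the two structural clauses that `YM3IR/CovariantFamily.lean`
adds to the one conjecture — gauge covariance `BlockFamily.IsGaugeCovariantOn` (Bałaban CMP 98 (11)) and block locality
`BlockFamily.IsBlockLocalOn` (a property of Bałaban's average (15), CMP 98 p. 19; tree axiom `Setup.Averaging.local_dep`) —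
in the TORUS types of track Y4 (`GaugeConfig 3 (b·M) G → GaugeConfig 3 M G`): the
crudest renormalisation-group-type block map, the AXIAL average `V(y, i) := U(b·y, i) U(b·y + eᵢ, i) ⋯ U(b·y + (b−1)eᵢ, i)`
(parallel transport along the straight line of `b` links from the corner `b·y` to the corner `b·(y + eᵢ)`; B5 (1.7)/(1.11)),
is a measurable `BlockFamily` that IS gauge-covariant (re-labelling `emb := liftSite`, the block corners) and IS block-local
(`isGaugeCovariantOn_axialFamily`, `isBlockLocalOn_axialFamily`; PROVED, elementary). It is the torus-typed twin of the
tree's `Balaban1983to89.AveragingRT.axial` (the inhabitant of `Setup.Averaging` in Bałaban's own lattice types) and, like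
it, is NOT Bałaban's weighted average (15) (which needs the group mean `M`). WHAT THIS IS NOT: no claim that the axial
family (or any family) satisfies clause (a) `EntersClusterDomain` or (b) `FluctuationDecoupling` — its images of Wilson
laws carry the `b × b` Wilson loops and are neither product Haar (unlike the forest's) nor known to lie in any ball; no
Yang–Mills claim, no continuum, no axiom, no `sorry`, `0` compute. So: «theorem under the hypothesis `IRConjecture3Cov`»
is a theorem about a NON-EMPTY structural class (this file) that EXCLUDES the forest (`CovariantFamily.lean`).

WHY THIS IS NOVEL (one sentence). It closes the «theorem about nothing?» question for the covariant typing the same day it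
was posed, by the one-induction telescoping certificate, so that the Monday reader sees both edges of the new clause:
the forest is out, the straight-line transport is in.

## References
* T. Bałaban, CMP 95 (1984) 17, (1.7) p.18 (straight contours), (1.11) p.19 (axial gauge) [cite: Balaban1984PropagatorsI];
  CMP 98 (1985) 17, (11) p.19 (gauge covariance; (12)–(13) p.19 verify gauge invariance of `ρ'`) and the average (15) p.19
  (block locality = tree axiom `Setup.Averaging.local_dep`, no numbered display). [cite: Balaban1985Averaging]
* Tree: `Literature/…/Balaban1983to89/AveragingRT.lean` §4 (`axialAvg_covariant`, `axialAvg_local`).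
-/

noncomputable section

open MeasureTheory
open Literature.MathematicalPhysics.QuantumLattice Literature.MathematicalPhysics.QuantumFieldTheory

namespace Summit.Ventures.YMGap.YM3IR

section Line

/-- The `t`-th site `b·y + t·eᵢ` of the straight line issuing from the corner `b·y` in direction `i`. [cite: Balaban1985Averaging, (15) p.19] -/
def lineSite (b M : ℕ) (y : Site 3 M) (i : Fin 3) (t : ℕ) : Site 3 (b * M) :=
  liftSite b M y + Pi.single i (t : ZMod (b * M))

/-- The line starts at the corner. [folklore] -/
theorem lineSite_zero (b M : ℕ) (y : Site 3 M) (i : Fin 3) : lineSite b M y i 0 = liftSite b M y := by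
  simp [lineSite]

/-- Consecutive line sites differ by `eᵢ`. [folklore] -/
theorem lineSite_succ (b M : ℕ) (y : Site 3 M) (i : Fin 3) (t : ℕ) :
    lineSite b M y i (t + 1) = (lineSite b M y i t).shift i := by
  simp only [lineSite, Site.shift, Nat.cast_succ, Pi.single_add, add_assoc]

/-- After `b` steps the line reaches the next corner: `b·y + b·eᵢ = b·(y + eᵢ)` on the fine torus. [folklore] -/
theorem lineSite_factor {b M : ℕ} [NeZero M] (y : Site 3 M) (i : Fin 3) :
    lineSite b M y i b = liftSite b M (y.shift i) := by
  funext j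
  simp only [lineSite, Site.shift, Pi.add_apply, liftSite]
  by_cases hj : j = i
  · subst hj
    rw [Pi.single_eq_same, Pi.single_eq_same, ZMod.val_add, ZMod.val_one_eq_one_mod, ← Nat.cast_add,
      ZMod.natCast_eq_natCast_iff', Nat.add_mod_mod, show b * (y j).val + b = b * ((y j).val + 1) by ring,
      Nat.mul_mod_mul_left, Nat.mul_mod_mul_left, Nat.mod_mod]
  · rw [Pi.single_eq_of_ne hj, Pi.single_eq_of_ne hj, add_zero, add_zero]

/-- Every site of the line before the next corner lies in the block `y`. [folklore] -/
theorem blockOf_lineSite {b M : ℕ} [NeZero M] (hb : 0 < b) (y : Site 3 M) (i : Fin 3) {t : ℕ} (ht : t < b) :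
    blockOf b M (lineSite b M y i t) = y := by
  have hval : ∀ j, (liftSite b M y j).val = b * (y j).val := fun j => by
    simp only [liftSite, ZMod.val_natCast]
    exact Nat.mod_eq_of_lt (mul_lt_mul_of_pos_left (ZMod.val_lt (y j)) hb)
  funext j
  simp only [blockOf, lineSite, Pi.add_apply]
  by_cases hj : j = i
  · subst hj
    rw [Pi.single_eq_same]
    have hlt : b * (y j).val + t < b * M := by
      calc b * (y j).val + t < b * (y j).val + b := by omega
        _ = b * ((y j).val + 1) := by ring
        _ ≤ b * M := Nat.mul_le_mul_left b (ZMod.val_lt (y j))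
    have ht' : (t : ZMod (b * M)).val = t := ZMod.val_natCast_of_lt (lt_of_le_of_lt (by omega) hlt)
    have hsum : (liftSite b M y j + (t : ZMod (b * M))).val = b * (y j).val + t := by
      rw [ZMod.val_add_of_lt, hval, ht']
      rw [hval, ht']; exact hlt
    rw [hsum, Nat.mul_add_div hb, Nat.div_eq_of_lt ht, add_zero, ZMod.natCast_zmod_val]
  · rw [Pi.single_eq_of_ne hj, add_zero, hval, Nat.mul_div_cancel_left _ hb, ZMod.natCast_zmod_val]

end Line

section Axial

variable {G : Type} [Group G]

/-- Ordered product `U(b·y, i) U(b·y + eᵢ, i) ⋯` of the first `n` links of the line (parallel transport). [cite: Balaban1985Averaging, (15) p.19] -/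
def linePathProd (b M : ℕ) (U : GaugeConfig 3 (b * M) G) (y : Site 3 M) (i : Fin 3) : ℕ → G
  | 0 => 1
  | n + 1 => linePathProd b M U y i n * U (lineSite b M y i n, i)

/-- **The axial block map:** the coarse link `(y, i)` is the transport along the straight line of `b` fine links from
`b·y` to `b·(y + eᵢ)`. [cite: Balaban1985Averaging, (15) p.19] -/
def axialBlk (b M : ℕ) (U : GaugeConfig 3 (b * M) G) : GaugeConfig 3 M G :=
  fun e => linePathProd b M U e.1 e.2 b

/-- Gauge covariance of the partial transports: `P_n(U^g) = g(b·y) P_n(U) g(xₙ)⁻¹` (telescoping). [cite: Balaban1985Averaging, (11) p.19] -/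
theorem linePathProd_gaugeTransform (b M : ℕ) (g : Site 3 (b * M) → G) (U : GaugeConfig 3 (b * M) G) (y : Site 3 M)
    (i : Fin 3) (n : ℕ) :
    linePathProd b M (gaugeTransform g U) y i n =
      g (liftSite b M y) * linePathProd b M U y i n * (g (lineSite b M y i n))⁻¹ := by
  induction n with
  | zero => simp [linePathProd, lineSite_zero]
  | succ n ih =>
    simp only [linePathProd, ih, gaugeTransform, lineSite_succ]
    group

variable [MeasurableSpace G] [MeasurableMul₂ G]

/-- The partial transports are measurable in the fine field. [folklore] -/
theorem measurable_linePathProd (b M : ℕ) (y : Site 3 M) (i : Fin 3) :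
    ∀ n, Measurable (fun U : GaugeConfig 3 (b * M) G => linePathProd b M U y i n)
  | 0 => measurable_const
  | n + 1 => (measurable_linePathProd b M y i n).mul (measurable_pi_apply _)

/-- The axial block map is measurable. [folklore] -/
theorem measurable_axialBlk (b M : ℕ) : Measurable (axialBlk (G := G) b M) :=
  measurable_pi_lambda _ fun e => measurable_linePathProd b M e.1 e.2 b

/-- **The axial block family** with block factor `b(β)`: block map = axial transport at every coupling and side (an
admissible, measurable `BlockFamily`). [cite: Balaban1985Averaging, (15) p.19] -/
def axialFamily (b : ℝ → ℕ) (hb : ∀ β, 0 < b β) : BlockFamily G where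
  factor := b
  factor_pos := hb
  blk β M := axialBlk (b β) M
  measurable_blk β M := measurable_axialBlk (b β) M

/-- The axial family's block factor is `b`. [folklore] -/
@[simp] theorem axialFamily_factor (b : ℝ → ℕ) (hb : ∀ β, 0 < b β) (β : ℝ) :
    (axialFamily (G := G) b hb).factor β = b β := rfl

/-- **The axial family is gauge-COVARIANT at every `(β, M)` for the corner re-labelling `liftSite`** (Bałaban's (11)):
`V(U^g)(y,i) = g(b·y) V(U)(y,i) g(b·(y+eᵢ))⁻¹`. [cite: Balaban1985Averaging, (11) p.19] -/
theorem covariantAt_axialFamily (b : ℝ → ℕ) (hb : ∀ β, 0 < b β) (β : ℝ) (M : ℕ) [NeZero M] :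
    (axialFamily (G := G) b hb).CovariantAt β M (liftSite (b β) M) := by
  intro g U
  funext e
  show linePathProd (b β) M (gaugeTransform g U) e.1 e.2 (b β) =
    g (liftSite (b β) M e.1) * linePathProd (b β) M U e.1 e.2 (b β) * (g (liftSite (b β) M (e.1.shift e.2)))⁻¹
  rw [linePathProd_gaugeTransform, lineSite_factor]

/-- **The axial family is gauge-covariant along every coupling set** (PROVED). [cite: Balaban1985Averaging, (11) p.19] -/
theorem isGaugeCovariantOn_axialFamily (b : ℝ → ℕ) (hb : ∀ β, 0 < b β) (I : Set ℝ) :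
    (axialFamily (G := G) b hb).IsGaugeCovariantOn I :=
  fun β _ M _ => ⟨liftSite (b β) M, covariantAt_axialFamily b hb β M⟩

/-- **The axial family is block-local** (PROVED): the coarse link `(y,i)` depends only on the `b` fine links of its line,
all of which start in the block `y` (locality of Bałaban's average (15); tree `Setup.Averaging.local_dep`). [cite: Balaban1985Averaging, (15) p.19] -/
theorem isBlockLocalOn_axialFamily (b : ℝ → ℕ) (hb : ∀ β, 0 < b β) (I : Set ℝ) :
    (axialFamily (G := G) b hb).IsBlockLocalOn I := by
  intro β _ M _ e
  show DependsOn (fun U : GaugeConfig 3 (b β * M) G => linePathProd (b β) M U e.1 e.2 (b β))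
    {x : Edge 3 (b β * M) | blockOf (b β) M x.1 = e.1 ∨ blockOf (b β) M x.1 = e.1.shift e.2}
  intro U U' h
  have key : ∀ n, n ≤ b β → linePathProd (b β) M U e.1 e.2 n = linePathProd (b β) M U' e.1 e.2 n := by
    intro n hn
    induction n with
    | zero => rfl
    | succ n ih =>
      have hx : U (lineSite (b β) M e.1 e.2 n, e.2) = U' (lineSite (b β) M e.1 e.2 n, e.2) :=
        h _ (Or.inl (blockOf_lineSite (hb β) e.1 e.2 (Nat.lt_of_succ_le hn)))
      simp only [linePathProd]
      rw [ih (Nat.le_of_succ_le hn), hx]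
  exact key _ le_rfl

/-- **CONSISTENCY CERTIFICATE: the structural clauses of `IRConjecture3Cov` are jointly inhabited** — by the axial family,
for every block-factor function and every coupling set (PROVED). Nothing is claimed about clauses (a), (b). [folklore] -/
theorem exists_gaugeCovariant_blockLocal (b : ℝ → ℕ) (hb : ∀ β, 0 < b β) (I : Set ℝ) :
    ∃ W : BlockFamily G, (∀ β, W.factor β = b β) ∧ W.IsGaugeCovariantOn I ∧ W.IsBlockLocalOn I :=
  ⟨axialFamily b hb, fun _ => rfl, isGaugeCovariantOn_axialFamily b hb I, isBlockLocalOn_axialFamily b hb I⟩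

end Axial

/-- **On `SU(2)` and Bałaban's coupling set: the forest is OUT, the axial transport is IN** (PROVED; the two edges of the
covariance clause side by side). [folklore] -/
theorem su2_covariance_clause_edges {L : ℕ} {eps0 : ℝ → ℝ} (b : ℝ → ℕ) (hb : ∀ β, 0 < b β) {β : ℝ}
    (hβ : β ∈ CarrierBridge.balabanCouplings L (Summit.QuantumFields.Balaban3D.Carriers.suGroupModel 2) eps0)
    (h2 : 2 ≤ b β) :
    ¬ (forestFamily (G := RobustBall.SUN 2) b hb).IsGaugeCovariantOn
        (CarrierBridge.balabanCouplings L (Summit.QuantumFields.Balaban3D.Carriers.suGroupModel 2) eps0) ∧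
      (axialFamily (G := RobustBall.SUN 2) b hb).IsGaugeCovariantOn
        (CarrierBridge.balabanCouplings L (Summit.QuantumFields.Balaban3D.Carriers.suGroupModel 2) eps0) :=
  ⟨forestFamily_not_covariant_on_balabanCouplings hβ h2, isGaugeCovariantOn_axialFamily b hb _⟩

end Summit.Ventures.YMGap.YM3IR

end
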